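import Literature.AnabelianGeometry.EtaleTheta.RealifiedDivisorMonoidsOfRlfR

/-!
# [EtTh] Def. 3.6 (iii)/(v): the non-cuspidal and cuspidal parts of `Φ₀^ℝ(Y)` for the CONSTRUCTED
# Def. 3.6 (i) data (`ofRlfZ`, `ofRlfR`) — down-closure and disjointness

Mochizuki, *The étale theta function …*, Publ. RIMS **45** (2009), Def. 3.6 (iii) p.77 and Def. 3.1 (i)
p.70 [cite: MochizukiEtTh2009, Def 3.6 p.77]: an element of `Φ^{ℝ-log}(A) = Φ₀^ℝ(A)` is non-cuspidal
(resp. cuspidal) if it "arises from a non-cuspidal (resp. cuspidal) log-divisor", i.e. (support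
reading, `RealifiedDivisorMonoidsOfRlf.lean` v3) is supported in the primes of the special fibre (resp.
of the divisor of cusps).  abc-iut cell, layer L2 (seat abc-iut-L6-t12; split (R1)/(R2) agreed with
abc-iut-L2-d2, 2026-08-25T23:51Z, toward their Cor. 3.8 (iii) corollary over `ofRlfZ`):
* (R1) supports in `M^rlf ⊆ ∏_𝔭 M^rlf_𝔭` are monotone under divisibility and invariant under powers
  `n ≥ 1`; hence the submonoids `rlfSuppIn h S` — in particular `(ofRlfZ dm hpf).ncspR Y`, `.cspR Y` —
  are DOWN-CLOSED under `∣` and ROOT-CLOSED (Def. 3.6 (v)(b)-type statements, (D2b));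
* (R2) if the prime sets `S`, `T` are disjoint then `rlfSuppIn h S ⊓ rlfSuppIn h T = ⊥`; hence
  `ncspR Y ⊓ cspR Y = ⊥` ((D2a)) as soon as the supports of the images of the non-cuspidal and of the
  cuspidal elements of `Φ₀(Y)` are disjoint — an input at the `Φ₀` level (abc-iut-L2-d2's
  `DivisorMonoidsCuspidal`), isolated here as `Disjoint (toRSuppOf … ncsp₀) (toRSuppOf … csp₀)` and
  reduced to the element-wise form by `disjoint_toRSuppOf_iff`.
Theorems only; no new definitions.
-/

namespace Literature.AnabelianGeometry.EtaleTheta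

open CategoryTheory Opposite Literature.AlgebraicGeometry.Frobenioids

universe u v w

/-! ### (R1) Supports in `M^rlf_factor`: monotone under divisibility, invariant under powers -/

section Supp

variable {M : Type w} [CommMonoid M]

/-- `a ∣ b ⇒ supp(a) ⊆ supp(b)` in `M^rlf_factor = ∏_𝔭 M^rlf_𝔭` (all coordinates are `≥ 0`).
[cite: MochizukiFrdI2008, Def. 2.4 (i) p.48] -/
theorem supp_subset_of_dvd {a b : RlfFactor M} (h : a ∣ b) : supp a ⊆ supp b := by
  obtain ⟨c, rfl⟩ := h
  exact supp_subset_supp_mul a c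

/-- `supp(a^n) ⊆ supp(a)`. [cite: MochizukiFrdI2008, Def. 2.4 (i) p.48] -/
theorem supp_pow_subset (a : RlfFactor M) (n : ℕ) : supp (a ^ n) ⊆ supp a := by
  induction n with
  | zero =>
    intro 𝔮 h𝔮
    exact (h𝔮 (by rw [pow_zero]; rfl)).elim
  | succ n ih =>
    rw [pow_succ]
    exact (supp_mul_subset _ _).trans (Set.union_subset ih subset_rfl)

/-- `supp(a^n) = supp(a)` for `n ≥ 1`. [cite: MochizukiFrdI2008, Def. 2.4 (i) p.48] -/
theorem supp_pow_eq (a : RlfFactor M) {n : ℕ} (hn : n ≠ 0) : supp (a ^ n) = supp a :=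
  (supp_pow_subset a n).antisymm (supp_subset_of_dvd (dvd_pow_self a hn))

/-- An element of `M^rlf_factor` with empty support is `1`. [cite: MochizukiFrdI2008, Def. 2.4 (i) p.48] -/
theorem eq_one_of_supp_subset_empty {a : RlfFactor M} (h : supp a ⊆ ∅) : a = 1 := by
  funext 𝔮
  by_contra hne
  exact h hne

end Supp

namespace RealifiedDivisorMonoids

section RlfSuppIn

variable {M : Type w} [CommMonoid M] (h : IsPerfFactorial M)

/-- `rlfSuppIn h S` is DOWN-CLOSED under divisibility in `M^rlf`.
[cite: MochizukiEtTh2009, Def 3.6 p.77] -/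
theorem rlfSuppIn_of_dvd (S : Set (Primes (Perfection M))) {x y : h.Rlf} (hxy : x ∣ y)
    (hy : y ∈ rlfSuppIn h S) : x ∈ rlfSuppIn h S :=
  (supp_subset_of_dvd (map_dvd h.realification.subtype hxy)).trans hy

/-- `rlfSuppIn h S` is ROOT-CLOSED in `M^rlf`: `x^n ∈ rlfSuppIn h S`, `n ≥ 1` ⇒ `x ∈ rlfSuppIn h S`.
[cite: MochizukiEtTh2009, Def 3.6 p.77] -/
theorem rlfSuppIn_of_pow_mem (S : Set (Primes (Perfection M))) {x : h.Rlf} {n : ℕ} (hn : n ≠ 0)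
    (hx : x ^ n ∈ rlfSuppIn h S) : x ∈ rlfSuppIn h S := by
  change supp ((h.realification.subtype x) ^ n) ⊆ S at hx
  rwa [supp_pow_eq _ hn] at hx

/-- Membership of a power: `x^n ∈ rlfSuppIn h S ↔ x ∈ rlfSuppIn h S` (`n ≥ 1`).
[cite: MochizukiEtTh2009, Def 3.6 p.77] -/
theorem pow_mem_rlfSuppIn_iff (S : Set (Primes (Perfection M))) (x : h.Rlf) {n : ℕ} (hn : n ≠ 0) :
    x ^ n ∈ rlfSuppIn h S ↔ x ∈ rlfSuppIn h S :=
  ⟨rlfSuppIn_of_pow_mem h S hn, fun hx => pow_mem hx n⟩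

/-! ### (R2) Disjoint prime sets give submonoids meeting in `1` -/

/-- If `S ∩ T = ∅` then `rlfSuppIn h S ⊓ rlfSuppIn h T = ⊥` (an element supported in both has empty
support, hence is `1`). [cite: MochizukiEtTh2009, Def 3.6 p.77] -/
theorem rlfSuppIn_inf_eq_bot_of_disjoint {S T : Set (Primes (Perfection M))} (hST : Disjoint S T) :
    rlfSuppIn h S ⊓ rlfSuppIn h T = ⊥ := by
  rw [eq_bot_iff]
  rintro x ⟨hxS, hxT⟩
  rw [Submonoid.mem_bot]
  apply Subtype.ext
  exact eq_one_of_supp_subset_empty fun 𝔮 h𝔮 => (Set.disjoint_left.mp hST (hxS h𝔮) (hxT h𝔮)).elim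

end RlfSuppIn

/-! ### The (non-)cuspidal parts of `Φ₀^ℝ(Y)` for `ofRlfZ` / `ofRlfR` -/

variable {D₀ : Type u} [Category.{v} D₀] (dm : DivisorMonoids.{u, v, w} D₀)
  (hpf : ∀ Y : D₀ᵒᵖ, IsPerfFactorial (dm.Φ₀.obj Y))

/-- `ofRlfR` has the same non-cuspidal parts as `ofRlfZ`. [cite: MochizukiEtTh2009, Def 3.6 p.77] -/
theorem ofRlfR_ncspR (Y : D₀ᵒᵖ) : (ofRlfR dm hpf).ncspR Y = (ofRlfZ dm hpf).ncspR Y := rfl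

/-- `ofRlfR` has the same cuspidal parts as `ofRlfZ`. [cite: MochizukiEtTh2009, Def 3.6 p.77] -/
theorem ofRlfR_cspR (Y : D₀ᵒᵖ) : (ofRlfR dm hpf).cspR Y = (ofRlfZ dm hpf).cspR Y := rfl

/-- The non-cuspidal part is the support submonoid of the non-cuspidal primes (unfolding).
[cite: MochizukiEtTh2009, Def 3.6 p.77] -/
theorem ofRlfZ_ncspR (Y : D₀ᵒᵖ) :
    (ofRlfZ dm hpf).ncspR Y = rlfSuppIn (hpf Y) (toRSuppOf dm hpf Y (dm.ncsp₀ Y)) := rfl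

/-- The cuspidal part is the support submonoid of the cuspidal primes (unfolding).
[cite: MochizukiEtTh2009, Def 3.6 p.77] -/
theorem ofRlfZ_cspR (Y : D₀ᵒᵖ) :
    (ofRlfZ dm hpf).cspR Y = rlfSuppIn (hpf Y) (toRSuppOf dm hpf Y (dm.csp₀ Y)) := rfl

/-- **(D2b) The non-cuspidal part of `Φ₀^ℝ(Y)` is down-closed under divisibility.**
[cite: MochizukiEtTh2009, Def 3.6 p.77] -/
theorem ofRlfZ_ncspR_of_dvd (Y : D₀ᵒᵖ) {x y : (hpf Y).Rlf} (hxy : x ∣ y)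
    (hy : y ∈ (ofRlfZ dm hpf).ncspR Y) : x ∈ (ofRlfZ dm hpf).ncspR Y :=
  rlfSuppIn_of_dvd (hpf Y) _ hxy hy

/-- **(D2b) The cuspidal part of `Φ₀^ℝ(Y)` is down-closed under divisibility.**
[cite: MochizukiEtTh2009, Def 3.6 p.77] -/
theorem ofRlfZ_cspR_of_dvd (Y : D₀ᵒᵖ) {x y : (hpf Y).Rlf} (hxy : x ∣ y)
    (hy : y ∈ (ofRlfZ dm hpf).cspR Y) : x ∈ (ofRlfZ dm hpf).cspR Y :=
  rlfSuppIn_of_dvd (hpf Y) _ hxy hy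

/-- The non-cuspidal part is root-closed: `x^n` non-cuspidal (`n ≥ 1`) iff `x` is.
[cite: MochizukiEtTh2009, Def 3.6 p.77] -/
theorem ofRlfZ_pow_mem_ncspR_iff (Y : D₀ᵒᵖ) (x : (hpf Y).Rlf) {n : ℕ} (hn : n ≠ 0) :
    x ^ n ∈ (ofRlfZ dm hpf).ncspR Y ↔ x ∈ (ofRlfZ dm hpf).ncspR Y :=
  pow_mem_rlfSuppIn_iff (hpf Y) _ x hn

/-- The cuspidal part is root-closed: `x^n` cuspidal (`n ≥ 1`) iff `x` is.
[cite: MochizukiEtTh2009, Def 3.6 p.77] -/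
theorem ofRlfZ_pow_mem_cspR_iff (Y : D₀ᵒᵖ) (x : (hpf Y).Rlf) {n : ℕ} (hn : n ≠ 0) :
    x ^ n ∈ (ofRlfZ dm hpf).cspR Y ↔ x ∈ (ofRlfZ dm hpf).cspR Y :=
  pow_mem_rlfSuppIn_iff (hpf Y) _ x hn

/-- The disjointness of the non-cuspidal and cuspidal prime sets of `Φ₀(Y)`, element-wise: the images
in `Φ₀(Y)^rlf` of a non-cuspidal `a` and a cuspidal `c` have disjoint supports (in print: a prime
log-divisor lies in the special fibre or is a cusp, not both — Def. 3.1 (i) p.70; at the `Φ₀` level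
this follows from the unique factorisation `existsUnique_ncsp_csp`, abc-iut-L2-d2).
[cite: MochizukiEtTh2009, Def 3.1 p.70] -/
theorem disjoint_toRSuppOf_iff (Y : D₀ᵒᵖ) (N C : Submonoid (dm.Φ₀.obj Y)) :
    Disjoint (toRSuppOf dm hpf Y N) (toRSuppOf dm hpf Y C) ↔
      ∀ a ∈ N, ∀ c ∈ C,
        Disjoint (supp ((hpf Y).realification.subtype (((toRlfNatTrans dm.Φ₀ hpf).app Y).hom a)))
          (supp ((hpf Y).realification.subtype (((toRlfNatTrans dm.Φ₀ hpf).app Y).hom c))) := by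
  simp only [toRSuppOf, Set.disjoint_iUnion_left, Set.disjoint_iUnion_right, SetLike.mem_coe]
  exact ⟨fun h a ha c hc => h c hc a ha, fun h c hc a ha => h a ha c hc⟩

/-- **(D2a) The non-cuspidal and cuspidal parts of `Φ₀^ℝ(Y)` meet in `1`**, given the disjointness of
the non-cuspidal and cuspidal primes of `Φ₀(Y)`. [cite: MochizukiEtTh2009, Def 3.6 p.77] -/
theorem ofRlfZ_ncspR_inf_cspR_eq_bot (Y : D₀ᵒᵖ)
    (hdisj : Disjoint (toRSuppOf dm hpf Y (dm.ncsp₀ Y)) (toRSuppOf dm hpf Y (dm.csp₀ Y))) :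
    (ofRlfZ dm hpf).ncspR Y ⊓ (ofRlfZ dm hpf).cspR Y = ⊥ :=
  rlfSuppIn_inf_eq_bot_of_disjoint (hpf Y) hdisj

/-- (D2a), element form: a simultaneously non-cuspidal and cuspidal element of `Φ₀^ℝ(Y)` is `1`.
[cite: MochizukiEtTh2009, Def 3.6 p.77] -/
theorem ofRlfZ_eq_one_of_mem_ncspR_of_mem_cspR (Y : D₀ᵒᵖ)
    (hdisj : Disjoint (toRSuppOf dm hpf Y (dm.ncsp₀ Y)) (toRSuppOf dm hpf Y (dm.csp₀ Y)))
    {x : (hpf Y).Rlf} (hn : x ∈ (ofRlfZ dm hpf).ncspR Y) (hc : x ∈ (ofRlfZ dm hpf).cspR Y) : x = 1 := by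
  have h := ofRlfZ_ncspR_inf_cspR_eq_bot dm hpf Y hdisj
  rw [eq_bot_iff] at h
  exact (Submonoid.mem_bot.mp (h ⟨hn, hc⟩))

end RealifiedDivisorMonoids

end Literature.AnabelianGeometry.EtaleTheta
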